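import Summits.MatrixMultiplication.OmegaCensus.DominoZpZpStructFourCore
import Summits.MatrixMultiplication.OmegaCensus.DominoZpZpScaled
import HarnessLib

/-!
# Structural cover theorem for part size `4` on `ZMod p × ZMod p`: normalised tuples, table check, assembly

ω-census `pub-omega`, family (b3), seat pub-omega-group gen 22.  Framing: lottery ticket; floor = certified bounds/negative
ranges.  VALUE: with `DominoZpZpStructFourCore.lean`, replaces the per-prime kernel enumerations of part size `4` by a table
of only `≈ p²/2` certified count vectors and a `p² + p + 2`-lookup completeness check; NOT progress on ω.

A GOOD quadruple of line values (`exists_goodQ`) scaled by a suitable unit `κ` of `ZMod p` is one of the NORMALISED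
REPEATED tuples `(1,1,b,c)` with `¬(b ≠ 1 ∧ c ≠ 1 ∧ b ≠ c ∧ b + c ≡ 2)`, `(0,0,1,c)`, `(0,0,0,1)`, `(0,0,0,0)`
(`exists_entry_of_goodQ`).  `checkFour p tt` checks that the key tree `tt` of a certified line table contains the count
vector (`cvNat`, code `polyBE 5`) of every normalised tuple; `exists_entry_structFour` then yields, for EVERY value function
of sum `4` on the `p²` points, a direction `j ≤ p`, a unit `k` and a table entry `e` with `e.1[(k·v) % p] =` the count along
`j` at `v` — the scaled cover hypothesis consumed by `DominoZpZpCells.no_law_cube_1de_of_onto_zpzp_of_cover` (whose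
normal-form clause is simply not used).  Per-prime instances: `DominoZqStructFourTable*.lean` + `DominoZqZqStructFourCells.lean`.
-/

namespace Summit.MatrixMultiplication.OmegaCensus

open Finset

namespace ZpZpDomino

/-! ## Normalised repeated tuples, the table check, and its soundness -/

section Table

/-- The count function of a quadruple of naturals: `#{i : nᵢ = v}`. [folklore] -/
def cnt4 (n₀ n₁ n₂ n₃ v : ℕ) : ℕ :=
  (if n₀ = v then 1 else 0) + (if n₁ = v then 1 else 0) + (if n₂ = v then 1 else 0) + (if n₃ = v then 1 else 0)

/-- The count VECTOR (length `p`) of a quadruple of naturals — the table key. [folklore] -/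
def cvNat (p n₀ n₁ n₂ n₃ : ℕ) : List ℕ := (List.range p).map (cnt4 n₀ n₁ n₂ n₃)

/-- The excluded (unit-passing) shape among the normalised tuples `(1, 1, b, c)`. [folklore] -/
def S1Nat (p b c : ℕ) : Bool := !(b == 1) && !(c == 1) && !(b == c) && ((b + c) % p == 2 % p)

/-- **Completeness check of a table tree against the normalised repeated tuples** (`p² + p + 2` lookups):
`(1,1,b,c)` for all `b, c < p` not of the excluded shape, `(0,0,1,c)` for all `c < p`, `(0,0,0,1)`, `(0,0,0,0)`.
[folklore] -/
def checkFour (p : ℕ) (tt : BTree) : Bool :=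
  ((List.range p).all fun b => (List.range p).all fun c =>
      S1Nat p b c || tt.mem (hornerS 5 (cvNat p 1 1 b c) 0)) &&
    (((List.range p).all fun c => tt.mem (hornerS 5 (cvNat p 0 0 1 c) 0)) &&
      (tt.mem (hornerS 5 (cvNat p 0 0 0 1) 0) && tt.mem (hornerS 5 (cvNat p 0 0 0 0) 0)))

/-- `cnt4 ≤ 4`. [folklore] -/
theorem cnt4_le (n₀ n₁ n₂ n₃ v : ℕ) : cnt4 n₀ n₁ n₂ n₃ v ≤ 4 := by
  unfold cnt4; split_ifs <;> omega

/-- Length of a count vector. [folklore] -/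
theorem length_cvNat (p n₀ n₁ n₂ n₃ : ℕ) : (cvNat p n₀ n₁ n₂ n₃).length = p := by simp [cvNat]

/-- Entries of a count vector. [folklore] -/
theorem getD_cvNat (p n₀ n₁ n₂ n₃ : ℕ) {w : ℕ} (hw : w < p) :
    (cvNat p n₀ n₁ n₂ n₃).getD w 0 = cnt4 n₀ n₁ n₂ n₃ w := by
  simp [cvNat, List.getD_eq_getElem?_getD, List.getElem?_range hw]

/-- **A successful lookup yields a table entry with that key.** [folklore] -/
theorem entry_of_lookup {p : ℕ} {T : List (List ℕ × List (ℕ × List ℕ))} {tt : BTree}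
    (htt : ∀ x, tt.mem x = true → x ∈ T.map fun e => polyBE 5 e.1) (hWF : tabWF p 5 T = true) {n₀ n₁ n₂ n₃ : ℕ}
    (h : tt.mem (hornerS 5 (cvNat p n₀ n₁ n₂ n₃) 0) = true) : ∃ e ∈ T, e.1 = cvNat p n₀ n₁ n₂ n₃ := by
  rw [hornerS_zero] at h
  have h2 := htt _ h
  rw [List.mem_map] at h2
  obtain ⟨e, he, hcode⟩ := h2
  simp only [tabWF, List.all_eq_true, Bool.and_eq_true, beq_iff_eq, decide_eq_true_eq] at hWF
  obtain ⟨helen, hedig⟩ := hWF e he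
  refine ⟨e, he, polyBE_inj (by rw [helen, length_cvNat]) hedig (fun x hx => ?_) hcode⟩
  simp only [cvNat, List.mem_map, List.mem_range] at hx
  obtain ⟨w, -, rfl⟩ := hx
  exact Nat.lt_succ_of_le (cnt4_le _ _ _ _ _)

variable {p : ℕ} [Fact p.Prime]

/-- The scaled count function read at `κ·v` is the count function of the original values at `v`. [folklore] -/
theorem cnt4_scaled {κ : ZMod p} (hκ : κ ≠ 0) (a₀ a₁ a₂ a₃ v : ZMod p) :
    cnt4 (κ * a₀).val (κ * a₁).val (κ * a₂).val (κ * a₃).val (κ * v).val =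
      (if a₀ = v then 1 else 0) + (if a₁ = v then 1 else 0) + (if a₂ = v then 1 else 0) + (if a₃ = v then 1 else 0) := by
  unfold cnt4
  simp only [(ZMod.val_injective p).eq_iff, mul_right_inj' hκ]

/-- From a table entry keyed by the scaled values to the count identity at every `v`. [folklore] -/
theorem getD_entry_scaled {κ : ZMod p} (hκ : κ ≠ 0) (a₀ a₁ a₂ a₃ : ZMod p) {e : List ℕ × List (ℕ × List ℕ)}
    (he : e.1 = cvNat p (κ * a₀).val (κ * a₁).val (κ * a₂).val (κ * a₃).val) (v : ZMod p) :
    e.1.getD (κ * v).val 0 =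
      (if a₀ = v then 1 else 0) + (if a₁ = v then 1 else 0) + (if a₂ = v then 1 else 0) + (if a₃ = v then 1 else 0) := by
  rw [he, getD_cvNat p _ _ _ _ (ZMod.val_lt _), cnt4_scaled hκ]

/-- **Normalisation**: a GOOD quadruple, scaled by a suitable unit `κ`, is one of the normalised repeated tuples, so a table
that passes `checkFour` has an entry keyed by its scaled count vector. [folklore] -/
theorem exists_entry_of_goodQ {T : List (List ℕ × List (ℕ × List ℕ))} {tt : BTree}
    (htt : ∀ x, tt.mem x = true → x ∈ T.map fun e => polyBE 5 e.1) (hWF : tabWF p 5 T = true)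
    (hchk : checkFour p tt = true) {a₀ a₁ a₂ a₃ : ZMod p}
    (hq : a₀ = a₁ ∧ ¬ (a₂ ≠ a₀ ∧ a₃ ≠ a₀ ∧ a₂ ≠ a₃ ∧ a₂ + a₃ = a₀ + a₀ ∧ a₀ ≠ 0)) :
    ∃ κ : ZMod p, κ ≠ 0 ∧ ∃ e ∈ T, ∀ v : ZMod p, e.1.getD (κ * v).val 0 =
      (if a₀ = v then 1 else 0) + (if a₁ = v then 1 else 0) + (if a₂ = v then 1 else 0) + (if a₃ = v then 1 else 0) := by
  have hp1 : Fact (1 < p) := ⟨(Fact.out : p.Prime).one_lt⟩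
  simp only [checkFour, Bool.and_eq_true, List.all_eq_true, List.mem_range, Bool.or_eq_true] at hchk
  obtain ⟨hA, hB, hC, hD⟩ := hchk
  obtain ⟨h01, hex⟩ := hq
  by_cases ha₀ : a₀ = 0
  · by_cases ha₂ : a₂ = 0
    · by_cases ha₃ : a₃ = 0
      · -- (0,0,0,0)
        obtain ⟨e, he, hkey⟩ := entry_of_lookup htt hWF hD
        refine ⟨1, one_ne_zero, e, he, getD_entry_scaled one_ne_zero a₀ a₁ a₂ a₃ ?_⟩
        rw [hkey, ← h01, ha₀, ha₂, ha₃, mul_zero, ZMod.val_zero]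
      · -- (0,0,0,1)
        obtain ⟨e, he, hkey⟩ := entry_of_lookup htt hWF hC
        refine ⟨a₃⁻¹, inv_ne_zero ha₃, e, he, getD_entry_scaled (inv_ne_zero ha₃) a₀ a₁ a₂ a₃ ?_⟩
        rw [hkey, ← h01, ha₀, ha₂, mul_zero, ZMod.val_zero, inv_mul_cancel₀ ha₃, ZMod.val_one]
    · -- (0,0,1,c)
      obtain ⟨e, he, hkey⟩ := entry_of_lookup htt hWF (hB (a₂⁻¹ * a₃).val (ZMod.val_lt _))
      refine ⟨a₂⁻¹, inv_ne_zero ha₂, e, he, getD_entry_scaled (inv_ne_zero ha₂) a₀ a₁ a₂ a₃ ?_⟩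
      rw [hkey, ← h01, ha₀, mul_zero, ZMod.val_zero, inv_mul_cancel₀ ha₂, ZMod.val_one]
  · -- (1,1,b,c)
    set κ : ZMod p := a₀⁻¹ with hκdef
    have hκ : κ ≠ 0 := inv_ne_zero ha₀
    have hκa : κ * a₀ = 1 := inv_mul_cancel₀ ha₀
    have hS : S1Nat p (κ * a₂).val (κ * a₃).val = false := by
      rw [Bool.eq_false_iff]
      intro hS
      simp only [S1Nat, Bool.and_eq_true, Bool.not_eq_true', beq_eq_false_iff_ne, ne_eq, beq_iff_eq] at hS
      obtain ⟨⟨⟨hb1, hc1⟩, hbc⟩, hsum⟩ := hS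
      apply hex
      refine ⟨fun h => hb1 ?_, fun h => hc1 ?_, fun h => hbc ?_, ?_, ha₀⟩
      · rw [h, hκa, ZMod.val_one]
      · rw [h, hκa, ZMod.val_one]
      · rw [h]
      · have e1 := (ZMod.natCast_eq_natCast_iff' _ _ p).2 hsum
        rw [Nat.cast_add, ZMod.natCast_zmod_val, ZMod.natCast_zmod_val, Nat.cast_ofNat, ← mul_add] at e1
        have e2 : κ * (a₂ + a₃) = κ * (a₀ + a₀) := by rw [e1, mul_add, hκa]; norm_num
        exact (mul_right_inj' hκ).1 e2
    have hA' := hA (κ * a₂).val (ZMod.val_lt _) (κ * a₃).val (ZMod.val_lt _)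
    rw [hS, Bool.false_eq_true, false_or] at hA'
    obtain ⟨e, he, hkey⟩ := entry_of_lookup htt hWF hA'
    refine ⟨κ, hκ, e, he, getD_entry_scaled hκ a₀ a₁ a₂ a₃ ?_⟩
    rw [hkey, ← h01, hκa, ZMod.val_one]

end Table

/-! ## Assembly: the scaled cover hypothesis for part size `4` -/

section Assembly

variable {p : ℕ} [Fact p.Prime]

/-- **Structural cover theorem for part `4`.**  For an odd prime `p` and a certified table `T` whose key tree passes
`checkFour`, every value function `g` of sum `4` on the `p²` points has a direction `j ≤ p`, a unit `k` and an entry `e ∈ T`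
with `e.1[(k·v) % p] = (count of g along j at v)` — the scaled cover hypothesis of `DominoZpZpCells.lean` (its normal-form
clause is not needed). [folklore] -/
theorem exists_entry_structFour (hp2 : p ≠ 2) (T : List (List ℕ × List (ℕ × List ℕ))) (tt : BTree)
    (htt : ∀ x, tt.mem x = true → x ∈ T.map fun e => polyBE 5 e.1) (hWF : tabWF p 5 T = true)
    (hchk : checkFour p tt = true) (g : Fin (p * p) → ℕ) (hg : ∑ i, g i = 4) :
    ∃ j < p + 1, ∃ k : ℕ, k % p ≠ 0 ∧ ∃ e ∈ T, ∀ v < p,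
      e.1.getD (k * v % p) 0 = ∑ i : Fin (p * p), pick v (pv p j i.val) (g i) := by
  haveI : NeZero p := ⟨(Fact.out : p.Prime).ne_zero⟩
  set H : ZMod p × ZMod p → ℕ := fun w => g ((ptEquiv p).symm w) with hH
  have hsum : ∑ w, H w = 4 := by
    rw [← hg]
    exact Fintype.sum_equiv (ptEquiv p).symm H g fun w => rfl
  obtain ⟨u, hu⟩ := exists_tuple_of_sum_eq 4 H hsum
  obtain ⟨j, hj, σ, hgood⟩ := exists_goodQ hp2 u
  have hcnt : ∀ v < p, ∑ i : Fin (p * p), pick v (pv p j i.val) (g i) =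
      ∑ i : Fin 4, if lineDir p j (u (σ i)) = ((v : ℕ) : ZMod p) then 1 else 0 := by
    intro v hv
    have e1 := sum_filter_eq_sum_pick p j H hv
    have e2 : ∀ i : Fin (p * p), H (pt p i.val) = g i := fun i => by
      show g ((ptEquiv p).symm (ptEquiv p i)) = g i
      rw [Equiv.symm_apply_apply]
    simp only [e2] at e1
    rw [← e1]
    simp only [hu]
    rw [sum_filter_tuple_count u (lineDir p j) ((v : ℕ) : ZMod p)]
    exact (Equiv.sum_comp σ (fun i => if lineDir p j (u i) = ((v : ℕ) : ZMod p) then 1 else 0)).symm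
  obtain ⟨κ, hκ, e, he, hev⟩ := exists_entry_of_goodQ htt hWF hchk hgood
  refine ⟨j, hj, κ.val, ?_, e, he, fun v hv => ?_⟩
  · rw [Nat.mod_eq_of_lt (ZMod.val_lt κ)]
    exact (ZMod.val_ne_zero κ).2 hκ
  · rw [hcnt v hv, Fin.sum_univ_four]
    have h1 := hev ((v : ℕ) : ZMod p)
    rw [ZMod.val_mul, ZMod.val_natCast, Nat.mod_eq_of_lt hv] at h1
    exact h1

end Assembly

end ZpZpDomino

end Summit.MatrixMultiplication.OmegaCensus
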